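import Summits.ResolutionOfSingularities.ResolutionOfSingularities.Theorems.MarkedTransferCampaignG1PnegaObligationF33StdIIFirst
import Literature.Barriers.ResolutionOfSingularities.NarasimhanMaximalContact
import HarnessLib

/-!
# [OURS · L1 G1 ℘nega-INTERFACE / RESCUE bed-type datum] The page's `H♭`-datum at a GENUINE WILD head — NARASIMHAN's hypersurface
# `y² + xz³ + zw³ + x⁷w` in characteristic 2 (Kollár 2007 Aside 3.57; tree `narasimhanPoly`): PART A — objects, standard expression,
# frontier data, the datum at a GENERIC placement (Case (III), order clause met). By res-type-063 (gen 7); carried by res-L1-type-o6.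
# PART B (`…NarasimhanCells`): `H♭(ϵ(0)) = x z³`, degree `−2`, and the cells SW ✓ (class regime) / PW ✗.

CARRIER NOTE (res-L1-type-o6 g20): KERNEL by res-type-063 (HOME draft `D/res-type-063/PnegaObligationF33StdNarasimhan.draft.lean` sha16
44ef3ad178f7106a, DRAFT READY + CARRY ask 2026-08-27T07:14:45Z, TAKING 07:16Z), summit-side VERBATIM (this note and the by-line clause
added). [OURS · L1 G1] replaces the role of: nothing printed beyond what the decl docstrings cite — OURS objects (exponent vectors, the three
monomials of `ϵ(0)`, the standard expression with its frontier data, and the `HFlatDatum` / `HFlatDatumOrd` at a GENERIC placement) instantiating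
the printed recipe at the tree's Narasimhan head; a bed-type DATUM for the retyped obligation F3.3, no printed item; NOT a statement of the manuscript.
HONEST FRAMING. Nothing here is a statement of H. Hironaka's manuscript *Resolution of singularities in positive characteristics*
(2017-03-23, [Hironaka2017], lit key `paper:url-3343fd9e678b`; every printed item is a CANDIDATE [claim: Hironaka2017, status:
under-review]). The datum is OURS: one instance of the printed recipe (standard expression (76) §8.4/p.49, §8.3 (1)–(2), Lem. 9.5, the
cleaning identities, Lem. 9.6) typed as `PnegaObligation.HFlatDatum` (p496649), at the completion `K[[y,x,z,w]]` of the classical hypersurface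
whose top locus admits no smooth hypersurface of maximal contact ([Kollar2007, Aside 3.57]; tree barrier
`Literature/Barriers/ResolutionOfSingularities/NarasimhanMaximalContact`, `narasimhanPoly`). WHY: the ✗ data of record of the F3.3 columns
(`CaseIIIDatum` at `𝔪^·`, p497285; `CylDatum` at `(x₀^·)`, p506088) sit at placements carrying no genuinely NEW head of level `q = p^e`,
`e > 0` (typer's caveat, HOME/STATUS 2026-08-27T06:53:11Z); here the head is the standard wild one (`y²` + order-4 terms, no order-1
maximal contact), and the PLACEMENT IS LEFT GENERIC: any `P : ℕ → Ideal K[[x]]` with the head in `P 2` (reading (c) of `F33std`) — in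
particular the manuscript's own `℘(E,·)` of `E = ((g), 2)` if one grants that it is a guarded filtration. AI kernel work, weaker than expert
review; nothing here is progress on resolution of singularities in positive characteristic; no verdict on any printed statement.

## The datum (variables `X 0 = y, X 1 = x, X 2 = z, X 3 = w` as in `narasimhanPoly`; `p = 2`, `e = 1`, `q = 2`)
`g = y² + ϵ(0)`, `ϵ(0) = x z³ + z w³ + x⁷ w` (`ord ϵ(0) = 4 > q`, `ord g = 2 = q`). Standard expression (§8.4): three terms `x z·(z)²`, `z w·(w)²`,
`x w·(x³)²`: `(a,b,c) ∈ {(e_x+e_z, 0, e_z), (e_z+e_w, 0, e_w), (e_x+e_w, 0, 3e_x)}`, coefficients `1`. Lex-top pair `α = e_x + e_z`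
(`(0,1,1,0) >lex (0,1,0,1) >lex (0,0,1,1)`), `β = 0`, top block `{x z³}`, `γ₀ = e_z`, `u₀ = 1`. Lem. 9.5: depth `5 > |α+pβ+qγ₀| = 4 > q`.
Cleaning: `∂^{(α)}y² = 0 = ∂^{(2γ₀)}y²`. Lem. 9.6: `|α+pβ| = 2 = q = |qγ₀|`, `|γ₀| = 1` — Case (III). ORDER clause `ord ϵ(0) = 4 = |α+pβ+qγ₀|` met.
-/

noncomputable section

set_option linter.dupNamespace false -- mandated namespace of this single-conjunct summit

namespace Summit.ResolutionOfSingularities.ResolutionOfSingularities.Theorems.Campaign.PnegaObligation.NarasimhanDatum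

open Literature.AlgebraicGeometry.Hironaka2017 Literature.AlgebraicGeometry.Hironaka2017.S09LLUED
open Literature.AlgebraicGeometry.Hironaka2017.S08UnitMonomial (StandardExpression U46_3_ours)
open Literature.RingTheory.MvPowerSeries (hasseDeriv hasseDeriv_monomial prod_choose_eq adicOrder_eq_order)
open Literature.AlgebraicGeometry.Resolution (adicOrder)
open MvPowerSeries (X monomial coeff)

universe u

variable (K : Type u) [Field K]

/-! ## §1 Exponents, the three monomials, the head -/

/-- Exponent vectors `(a, b, c, d)` on `(y, x, z, w) = (X 0, X 1, X 2, X 3)`. [folklore] -/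
def nu (a b c d : ℕ) : Fin 4 →₀ ℕ :=
  Finsupp.single 0 a + Finsupp.single 1 b + Finsupp.single 2 c + Finsupp.single 3 d

/-- Coordinate `y`. [folklore] -/
@[simp] theorem nu_zero (a b c d : ℕ) : nu a b c d 0 = a := by simp [nu]
/-- Coordinate `x`. [folklore] -/
@[simp] theorem nu_one (a b c d : ℕ) : nu a b c d 1 = b := by simp [nu]
/-- Coordinate `z`. [folklore] -/
@[simp] theorem nu_two (a b c d : ℕ) : nu a b c d 2 = c := by simp [nu]
/-- Coordinate `w`. [folklore] -/
@[simp] theorem nu_three (a b c d : ℕ) : nu a b c d 3 = d := by simp [nu]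

/-- Total degree of `nu`. [folklore] -/
theorem degree_nu (a b c d : ℕ) : (nu a b c d).degree = a + b + c + d := by
  rw [nu, map_add, map_add, map_add, Finsupp.degree_single, Finsupp.degree_single, Finsupp.degree_single, Finsupp.degree_single]

/-- Equality of `nu`-vectors is coordinatewise. [folklore] -/
theorem nu_eq_iff {a b c d a' b' c' d' : ℕ} : nu a b c d = nu a' b' c' d' ↔ a = a' ∧ b = b' ∧ c = c' ∧ d = d' := by
  constructor
  · intro h
    exact ⟨by simpa using DFunLike.congr_fun h 0, by simpa using DFunLike.congr_fun h 1, by simpa using DFunLike.congr_fun h 2,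
      by simpa using DFunLike.congr_fun h 3⟩
  · rintro ⟨rfl, rfl, rfl, rfl⟩; rfl

/-- Comparison of `nu`-vectors is coordinatewise. [folklore] -/
theorem nu_le_nu_iff {a b c d a' b' c' d' : ℕ} : nu a b c d ≤ nu a' b' c' d' ↔ a ≤ a' ∧ b ≤ b' ∧ c ≤ c' ∧ d ≤ d' := by
  constructor
  · intro h; exact ⟨by simpa using h 0, by simpa using h 1, by simpa using h 2, by simpa using h 3⟩
  · rintro ⟨h0, h1, h2, h3⟩ i; fin_cases i <;> simpa

/-- `ϵ(0) = x z³ + z w³ + x⁷ w`. [folklore] -/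
def eps : MvPowerSeries (Fin 4) K :=
  X 1 * X 2 ^ 3 + X 2 * X 3 ^ 3 + X 1 ^ 7 * X 3

/-- The head `g = y² + ϵ(0)` — Narasimhan's polynomial. [folklore] -/
def head : MvPowerSeries (Fin 4) K := X 0 ^ 2 + eps K

/-- A variable as a monomial. [folklore] -/
theorem X_eq_monomial (s : Fin 4) : (X s : MvPowerSeries (Fin 4) K) = monomial (Finsupp.single s 1) 1 := by
  rw [← pow_one (X s : MvPowerSeries (Fin 4) K), MvPowerSeries.X_pow_eq]

/-- `ϵ(0)` as a sum of three monomials: exponents `(0,1,3,0)`, `(0,0,1,3)`, `(0,7,0,1)`. [folklore] -/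
theorem eps_eq : eps K = monomial (nu 0 1 3 0) 1 + monomial (nu 0 0 1 3) 1 + monomial (nu 0 7 0 1) 1 := by
  have h1 : Finsupp.single (1 : Fin 4) 1 + Finsupp.single 2 3 = nu 0 1 3 0 := by ext i; fin_cases i <;> simp
  have h2 : Finsupp.single (2 : Fin 4) 1 + Finsupp.single 3 3 = nu 0 0 1 3 := by ext i; fin_cases i <;> simp
  have h3 : Finsupp.single (1 : Fin 4) 7 + Finsupp.single 3 1 = nu 0 7 0 1 := by ext i; fin_cases i <;> simp
  rw [eps, MvPowerSeries.X_pow_eq, MvPowerSeries.X_pow_eq, MvPowerSeries.X_pow_eq, X_eq_monomial K 1, X_eq_monomial K 2,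
    X_eq_monomial K 3, MvPowerSeries.monomial_mul_monomial, MvPowerSeries.monomial_mul_monomial, MvPowerSeries.monomial_mul_monomial,
    mul_one, h1, h2, h3]

/-- The head is the tree's `narasimhanPoly` (Kollár 2007 Aside 3.57) mapped into `K[[y,x,z,w]]`. [folklore] -/
theorem coe_narasimhanPoly :
    ((Literature.Barriers.ResolutionOfSingularities.narasimhanPoly (k := K) : MvPolynomial (Fin 4) K) : MvPowerSeries (Fin 4) K) =
      head K := by
  simp only [Literature.Barriers.ResolutionOfSingularities.narasimhanPoly, head, eps, MvPolynomial.coe_add, MvPolynomial.coe_mul,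
    MvPolynomial.coe_pow, MvPolynomial.coe_X]
  ring

open Classical in
/-- Coefficients of `ϵ(0)`. [folklore] -/
theorem coeff_eps (m : Fin 4 →₀ ℕ) : coeff m (eps K) =
    (if m = nu 0 1 3 0 then 1 else 0) + (if m = nu 0 0 1 3 then 1 else 0) + (if m = nu 0 7 0 1 then 1 else 0) := by
  simp only [eps_eq, map_add, MvPowerSeries.coeff_monomial]

/-- Every coefficient of `ϵ(0)` in total degree `< 4` vanishes. [folklore] -/
theorem coeff_eps_eq_zero_of_degree_lt {m : Fin 4 →₀ ℕ} (hm : m.degree < 4) : coeff m (eps K) = 0 := by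
  classical
  rw [coeff_eps, if_neg, if_neg, if_neg, add_zero, add_zero] <;> rintro rfl <;> rw [degree_nu] at hm <;> omega

/-- `ord ϵ(0) = 4`. [folklore] -/
theorem order_eps : (eps K).order = (4 : ℕ) := by
  classical
  apply le_antisymm
  · have h := MvPowerSeries.order_le (f := eps K) (d := nu 0 1 3 0) (by
      rw [coeff_eps, if_pos rfl, if_neg, if_neg] <;> simp [nu_eq_iff])
    simpa [degree_nu] using h
  · exact MvPowerSeries.nat_le_order fun d hd => coeff_eps_eq_zero_of_degree_lt K hd

/-- `ord y² = 2`. [folklore] -/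
theorem order_X0_sq : ((X 0 : MvPowerSeries (Fin 4) K) ^ 2).order = (2 : ℕ) := by
  rw [MvPowerSeries.X_pow_eq, MvPowerSeries.order_monomial_of_ne_zero one_ne_zero, Finsupp.degree_single]

/-- `ord g = 2`. [folklore] -/
theorem order_head : (head K).order = (2 : ℕ) := by
  have hne : ((X 0 : MvPowerSeries (Fin 4) K) ^ 2).order ≠ (eps K).order := by
    rw [order_X0_sq, order_eps]; exact_mod_cast (show (2 : ℕ) ≠ 4 by omega)
  rw [head, MvPowerSeries.order_add_of_order_ne hne, order_X0_sq, order_eps]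
  exact inf_eq_left.mpr (by exact_mod_cast (show (2 : ℕ) ≤ 4 by omega))

/-! ## §2 The standard expression and its frontier data -/

/-- Term `x z · z²`: `(a,b,c) = (e_x+e_z, 0, e_z)`. [folklore] -/
def t₁ : TopFrontier.ExpTriple 4 := (nu 0 1 1 0, 0, nu 0 0 1 0)
/-- Term `z w · w²`: `(e_z+e_w, 0, e_w)`. [folklore] -/
def t₂ : TopFrontier.ExpTriple 4 := (nu 0 0 1 1, 0, nu 0 0 0 1)
/-- Term `x w · (x³)²`: `(e_x+e_w, 0, 3e_x)`. [folklore] -/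
def t₃ : TopFrontier.ExpTriple 4 := (nu 0 1 0 1, 0, nu 0 3 0 0)

/-- Distinct triples (`x`-digit). [folklore] -/
theorem t₁_ne_t₂ : t₁ ≠ t₂ := fun h => by
  have := congrArg (fun t : TopFrontier.ExpTriple 4 => t.1 1) h
  simp [t₁, t₂] at this
/-- Distinct triples (`z`-digit). [folklore] -/
theorem t₁_ne_t₃ : t₁ ≠ t₃ := fun h => by
  have := congrArg (fun t : TopFrontier.ExpTriple 4 => t.1 2) h
  simp [t₁, t₃] at this
/-- Distinct triples (`x`-digit). [folklore] -/
theorem t₂_ne_t₃ : t₂ ≠ t₃ := fun h => by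
  have := congrArg (fun t : TopFrontier.ExpTriple 4 => t.1 1) h
  simp [t₂, t₃] at this

/-- `∏ x_i^{f_i} = x^f` on four variables. [folklore] -/
theorem prod_X_pow (f : Fin 4 →₀ ℕ) : (∏ i, (X i : MvPowerSeries (Fin 4) K) ^ f i) = monomial f 1 := by
  have hf : Finsupp.single (0 : Fin 4) (f 0) + Finsupp.single 1 (f 1) + Finsupp.single 2 (f 2) + Finsupp.single 3 (f 3) = f := by
    ext i; fin_cases i <;> simp
  rw [Fin.prod_univ_four, MvPowerSeries.X_pow_eq, MvPowerSeries.X_pow_eq, MvPowerSeries.X_pow_eq, MvPowerSeries.X_pow_eq,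
    MvPowerSeries.monomial_mul_monomial, MvPowerSeries.monomial_mul_monomial, MvPowerSeries.monomial_mul_monomial, mul_one, mul_one,
    mul_one, hf]

/-- One (76)-term as a monomial (`p = 2`, `q = 2¹`): `x^a x^{2b} x^{2c} = x^{a+2b+2c}`. [folklore] -/
theorem term_eq (a b c : Fin 4 →₀ ℕ) :
    ((∏ i, (X i : MvPowerSeries (Fin 4) K) ^ a i) * (∏ i, (X i : MvPowerSeries (Fin 4) K) ^ (2 * b i)) *
        ∏ i, (X i : MvPowerSeries (Fin 4) K) ^ (2 ^ 1 * c i)) = monomial (a + 2 • b + 2 ^ 1 • c) 1 := by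
  have hb : (∏ i, (X i : MvPowerSeries (Fin 4) K) ^ (2 * b i)) = monomial (2 • b) 1 := by rw [← prod_X_pow]; rfl
  have hc : (∏ i, (X i : MvPowerSeries (Fin 4) K) ^ (2 ^ 1 * c i)) = monomial (2 ^ 1 • c) 1 := by rw [← prod_X_pow]; rfl
  rw [prod_X_pow, hb, hc, MvPowerSeries.monomial_mul_monomial, MvPowerSeries.monomial_mul_monomial, mul_one, mul_one]

/-- Exponent of `t₁`: `(0,1,3,0)`. [folklore] -/
theorem t₁_exp : nu 0 1 1 0 + 2 • (0 : Fin 4 →₀ ℕ) + 2 ^ 1 • nu 0 0 1 0 = nu 0 1 3 0 := by ext i; fin_cases i <;> simp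
/-- Exponent of `t₂`: `(0,0,1,3)`. [folklore] -/
theorem t₂_exp : nu 0 0 1 1 + 2 • (0 : Fin 4 →₀ ℕ) + 2 ^ 1 • nu 0 0 0 1 = nu 0 0 1 3 := by ext i; fin_cases i <;> simp
/-- Exponent of `t₃`: `(0,7,0,1)`. [folklore] -/
theorem t₃_exp : nu 0 1 0 1 + 2 • (0 : Fin 4 →₀ ℕ) + 2 ^ 1 • nu 0 3 0 0 = nu 0 7 0 1 := by ext i; fin_cases i <;> simp

/-- The three-term standard expression (§8.4 p.46; row 052a) of `ϵ(0)` in terms of `x = (y,x,z,w)` at `p = 2`, `e = 1`, any depth `ℓ`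
(digits `a_i ∈ {0,1} < 2`, `b = 0 < 2⁰`, coefficients `1 = 1^{2^ℓ} ∈ ρ^ℓ`). [folklore] -/
def stdExpr (ℓ : ℕ) : StandardExpression 2 (X : Fin 4 → MvPowerSeries (Fin 4) K) 1 ℓ (eps K) where
  support := {t₁, t₂, t₃}
  u := fun _ => 1
  u_mem := fun _ _ => ⟨1, one_pow _⟩
  u_unit_or_zero := fun _ _ => Or.inl isUnit_one
  a_lt := by
    intro t ht i
    simp only [Finset.mem_insert, Finset.mem_singleton] at ht
    rcases ht with rfl | rfl | rfl <;> fin_cases i <;> simp [t₁, t₂, t₃]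
  b_lt := by
    intro t ht j
    simp only [Finset.mem_insert, Finset.mem_singleton] at ht
    rcases ht with rfl | rfl | rfl <;> simp [t₁, t₂, t₃]
  sum_eq := by
    rw [Finset.sum_insert (by simp only [Finset.mem_insert, Finset.mem_singleton, not_or]; exact ⟨t₁_ne_t₂, t₁_ne_t₃⟩),
      Finset.sum_insert (by simp only [Finset.mem_singleton]; exact t₂_ne_t₃), Finset.sum_singleton, mul_one, mul_one, mul_one]
    show eps K = _ + (_ + _)
    rw [term_eq, term_eq, term_eq]
    show eps K = monomial (nu 0 1 1 0 + 2 • (0 : Fin 4 →₀ ℕ) + 2 ^ 1 • nu 0 0 1 0) 1 +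
      (monomial (nu 0 0 1 1 + 2 • (0 : Fin 4 →₀ ℕ) + 2 ^ 1 • nu 0 0 0 1) 1 + monomial (nu 0 1 0 1 + 2 • (0 : Fin 4 →₀ ℕ) + 2 ^ 1 • nu 0 3 0 0) 1)
    rw [t₁_exp, t₂_exp, t₃_exp, eps_eq, add_assoc]

variable (ℓ : ℕ)

/-- All three coefficients are non-zero. [folklore] -/
theorem effSupport_eq : TopFrontier.effSupport (stdExpr K ℓ).support (stdExpr K ℓ).u = {t₁, t₂, t₃} :=
  TopFrontier.effSupport_eq_self _ _ fun _ _ => one_ne_zero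

/-- `(0,0,1,1) <lex (0,1,1,0)` (first difference at the `x`-slot). [folklore] -/
theorem toLex_a₂_lt : toLex (nu 0 0 1 1) < toLex (nu 0 1 1 0) :=
  Finsupp.Lex.lt_iff.mpr ⟨1, fun j hj => by fin_cases j <;> simp at hj ⊢, by simp⟩

/-- `(0,1,0,1) <lex (0,1,1,0)` (first difference at the `z`-slot). [folklore] -/
theorem toLex_a₃_lt : toLex (nu 0 1 0 1) < toLex (nu 0 1 1 0) :=
  Finsupp.Lex.lt_iff.mpr ⟨2, fun j hj => by fin_cases j <;> simp at hj ⊢, by simp⟩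

/-- `(α, β) = (e_x+e_z, 0)` is the lexicographically largest pair. [folklore] -/
theorem isGreatest_t₁ : ∀ s ∈ TopFrontier.effSupport (stdExpr K ℓ).support (stdExpr K ℓ).u,
    TopFrontier.pairKey s ≤ TopFrontier.pairKey t₁ := by
  intro s hs
  rw [effSupport_eq] at hs
  simp only [Finset.mem_insert, Finset.mem_singleton] at hs
  rcases hs with rfl | rfl | rfl
  · exact le_rfl
  · exact Prod.Lex.toLex_le_toLex.mpr (Or.inl toLex_a₂_lt)
  · exact Prod.Lex.toLex_le_toLex.mpr (Or.inl toLex_a₃_lt)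

/-- The top term is present. [folklore] -/
theorem t₁_mem : t₁ ∈ TopFrontier.effSupport (stdExpr K ℓ).support (stdExpr K ℓ).u := by
  rw [effSupport_eq]; simp

/-- `α = e_x + e_z`. [folklore] -/
theorem alpha_eq : TopFrontier.alpha (stdExpr K ℓ).support (stdExpr K ℓ).u = nu 0 1 1 0 :=
  TopFrontier.alpha_eq_of_isGreatest _ _ (t₁_mem K ℓ) (isGreatest_t₁ K ℓ)

/-- `β = 0`. [folklore] -/
theorem beta_eq : TopFrontier.beta (stdExpr K ℓ).support (stdExpr K ℓ).u = 0 :=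
  TopFrontier.beta_eq_of_isGreatest _ _ (t₁_mem K ℓ) (isGreatest_t₁ K ℓ)

/-- `m + 1 ≥ 1`. [folklore] -/
theorem frontierLength_pos : 0 < TopFrontier.frontierLength (stdExpr K ℓ).support (stdExpr K ℓ).u :=
  (TopFrontier.frontierLength_pos_iff _ _).2 ⟨_, t₁_mem K ℓ⟩

/-- `γ₀ = e_z` (the top block is `{t₁}`). [folklore] -/
theorem gamma_zero_eq : TopFrontier.gamma (stdExpr K ℓ).support (stdExpr K ℓ).u ⟨0, frontierLength_pos K ℓ⟩ = nu 0 0 1 0 := by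
  have hmem := TopFrontier.gamma_mem_effSupport (T := (stdExpr K ℓ).support) (u := (stdExpr K ℓ).u) ⟨0, frontierLength_pos K ℓ⟩
  rw [alpha_eq, beta_eq, effSupport_eq, Finset.mem_insert, Finset.mem_insert, Finset.mem_singleton] at hmem
  rcases hmem with h | h | h
  · simpa [t₁] using congrArg (fun t : TopFrontier.ExpTriple 4 => t.2.2) h
  · have := congrArg (fun t : TopFrontier.ExpTriple 4 => t.1 1) h
    simp [t₂] at this
  · have := congrArg (fun t : TopFrontier.ExpTriple 4 => t.1 2) h
    simp [t₃] at this

/-- `u₀ = 1`. [folklore] -/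
theorem u0_eq : StdExpr76.u0 (stdExpr K ℓ).support (stdExpr K ℓ).u = 1 := by
  unfold StdExpr76.u0
  rw [dif_pos (frontierLength_pos K ℓ)]
  rfl

/-! ## §3 Hasse derivatives of monomials on four variables; the cleaning identities; §8.3; the datum -/

/-- `Δ_α x^θ = (∏ C(θ_s, α_s))·x^{θ−α}` for `α ≤ θ` (tree `hasseDeriv_monomial` with the binomial written over all four indices). [folklore] -/
theorem hasseDeriv_monomial_of_le {α θ : Fin 4 →₀ ℕ} (h : α ≤ θ) (c : K) :
    hasseDeriv α (monomial θ c) = monomial (θ - α) (((∏ s, (θ s).choose (α s) : ℕ) : K) * c) := by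
  classical
  rw [hasseDeriv_monomial, if_pos h]
  have key : (θ.prod fun s n => n.choose (α s)) = ∏ s, (θ s).choose (α s) := by
    have h1 := prod_choose_eq α (θ - α)
    rw [add_tsub_cancel_of_le h] at h1
    rw [h1]
    exact Finset.prod_congr rfl fun s _ => by rw [Finsupp.tsub_apply, add_tsub_cancel_of_le (h s)]
  rw [key]

/-- `Δ_α x^θ = 0` unless `α ≤ θ`. [folklore] -/
theorem hasseDeriv_monomial_of_not_le {α θ : Fin 4 →₀ ℕ} (h : ¬ α ≤ θ) (c : K) : hasseDeriv α (monomial θ c) = 0 := by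
  classical
  rw [hasseDeriv_monomial, if_neg h]

/-- `Δ_{(0,b,c,d)}` with `(b,c,d) ≠ 0` kills `y²` — the two cleaning identities `∂ϵ(0) = ∂g` (Rem. 9.9 L10–L11) for `∂ ∈ {∂^{(α)}, ∂^{(2γ₀)}}`.
[folklore] -/
theorem hasseDeriv_nu_X0_sq {b c d : ℕ} (h : 0 < b + c + d) : hasseDeriv (nu 0 b c d) ((X 0 : MvPowerSeries (Fin 4) K) ^ 2) = 0 := by
  rw [MvPowerSeries.X_pow_eq]
  apply hasseDeriv_monomial_of_not_le
  intro hle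
  have h1 := hle 1; have h2 := hle 2; have h3 := hle 3
  simp at h1 h2 h3
  omega

/-- §8.3 (1)–(2) (row 052a OURS form) for `(g, ϵ(0), y) = (head, eps, X 0)` at `q = 2`, with «g ∈ 𝔏(Ě)» read as `g ∈ P 2` (reading (c)) —
for ANY placement `P` holding the head in degree `2`. [folklore] -/
theorem std (P : ℕ → Ideal (MvPowerSeries (Fin 4) K)) (hg : head K ∈ P 2) :
    U46_3_ours 2 (X : Fin 4 → MvPowerSeries (Fin 4) K) (fun f => f ∈ P (2 ^ 1)) 1 (head K) (eps K) (X 0) where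
  y_mem := ⟨0, rfl⟩
  y_pow_eq := by rw [pow_one]; exact (add_sub_cancel_right _ _).symm
  ord_g := by rw [adicOrder_eq_order, order_head]; norm_num
  ord_lt := by rw [adicOrder_eq_order, order_eps]; exact_mod_cast (show 2 ^ 1 < 4 by norm_num)
  mem52 := by rw [pow_one]; exact hg

/-- **The Narasimhan `H♭`-datum** at a GENERIC placement `P ∋ g` in degree `q = 2` (module docstring): `p = 2`, `e = 1`, depth `5`, `y = X 0`,
the three-term standard expression, Case (III) of Lem. 9.6 (`0 < |α+pβ| = 2 ≤ |qγ₀| = 2 = q`, `|γ₀| = 1`). [folklore] -/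
def datum (P : ℕ → Ideal (MvPowerSeries (Fin 4) K)) (hg : head K ∈ P 2) : HFlatDatum 2 K 4 P where
  e := 1
  e_pos := one_pos
  depth := 5
  i₀ := 0
  g := head K
  ε0 := eps K
  S := stdExpr K 5
  std := std K P hg
  frontier_pos := frontierLength_pos K _
  u0_isUnit := by rw [u0_eq]; exact isUnit_one
  alpha_ne_zero := by rw [alpha_eq]; exact fun h => by simpa using DFunLike.congr_fun h 1
  q_lt_depth := by norm_num
  degree_lt_depth := by rw [alpha_eq, beta_eq, gamma_zero_eq, t₁_exp, degree_nu]; norm_num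
  clean₁ := by
    rw [alpha_eq, beta_eq, smul_zero, add_zero, head, map_add, hasseDeriv_nu_X0_sq K (by norm_num), zero_add]
  clean₂ := by
    have h2 : 2 ^ 1 • nu 0 0 1 0 = nu 0 0 2 0 := by ext i; fin_cases i <;> simp
    rw [gamma_zero_eq, h2, head, map_add, hasseDeriv_nu_X0_sq K (by norm_num), zero_add]
  case := HFlat.Case.III (by
    have h2 : 2 ^ 1 • nu 0 0 1 0 = nu 0 0 2 0 := by ext i; fin_cases i <;> simp
    refine ⟨?_, ?_, ?_, ?_⟩
    · rw [alpha_eq, beta_eq, smul_zero, add_zero, degree_nu]; norm_num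
    · rw [alpha_eq, beta_eq, gamma_zero_eq, smul_zero, add_zero, h2, degree_nu, degree_nu]
    · rw [gamma_zero_eq, h2, degree_nu]; norm_num
    · rw [gamma_zero_eq, degree_nu])

variable (P : ℕ → Ideal (MvPowerSeries (Fin 4) K)) (hg : head K ∈ P 2)

/-- `α` of the datum. [folklore] -/
theorem datum_alpha : (datum K P hg).α = nu 0 1 1 0 := alpha_eq K _
/-- `β` of the datum. [folklore] -/
theorem datum_beta : (datum K P hg).β = 0 := beta_eq K _
/-- `γ₀` of the datum. [folklore] -/
theorem datum_gamma : (datum K P hg).γ₀ = nu 0 0 1 0 := gamma_zero_eq K _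
/-- `q = 2`. [folklore] -/
theorem datum_q : (datum K P hg).q = 2 := rfl
/-- `u₀ = 1`. [folklore] -/
theorem datum_u0 : (datum K P hg).u₀ = 1 := Units.ext (by show StdExpr76.u0 (stdExpr K 5).support (stdExpr K 5).u = 1; exact u0_eq K 5)
/-- `α + pβ = e_x + e_z`. [folklore] -/
theorem datum_theta : (datum K P hg).α + 2 • (datum K P hg).β = nu 0 1 1 0 := by rw [datum_alpha, datum_beta, smul_zero, add_zero]
/-- `qγ₀ = 2e_z`. [folklore] -/
theorem datum_qgamma : (datum K P hg).q • (datum K P hg).γ₀ = nu 0 0 2 0 := by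
  rw [datum_gamma, datum_q]; ext i; fin_cases i <;> simp
/-- `α + pβ + qγ₀ = (0,1,3,0)`. [folklore] -/
theorem datum_exps : (datum K P hg).α + 2 • (datum K P hg).β + (datum K P hg).q • (datum K P hg).γ₀ = nu 0 1 3 0 := by
  rw [datum_theta, datum_qgamma]; ext i; fin_cases i <;> simp

/-- The datum MEETS the order clause of the reading of record (`HFlatDatumOrd`, p501470): `ord ϵ(0) = 4 = |α + pβ + qγ₀|`. [folklore] -/
def datumOrd : HFlatDatumOrd 2 K 4 P where
  toHFlatDatum := datum K P hg
  ord_eq := by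
    show adicOrder (eps K) = (((datum K P hg).α + 2 • (datum K P hg).β + (datum K P hg).q • (datum K P hg).γ₀).degree : ℕ∞)
    rw [adicOrder_eq_order, order_eps, datum_exps, degree_nu]

/-- Unfolding anchor: the ORDER-reading datum's underlying `H♭`-datum is `datum` (by `rfl`). [folklore] -/
theorem datumOrd_toHFlatDatum : (datumOrd K P hg).toHFlatDatum = datum K P hg := rfl

end Summit.ResolutionOfSingularities.ResolutionOfSingularities.Theorems.Campaign.PnegaObligation.NarasimhanDatum
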